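import Literature.NumberTheory.LFunctions.RudnickSarnakNSlotDecomp
import Literature.NumberTheory.LFunctions.RudnickSarnakNDiagonal
import HarnessLib

/-!
# Rudnick–Sarnak `n`-level correlations for `ζ`, XI: the patterns of the product and the main terms

Sibling file of `Literature/NumberTheory/LFunctions/RudnickSarnak.lean` (toward
`Literature.NumberTheory.LFunctions.rudnick_sarnak_unrestricted` at every level). Pointwise in a
point `ξ` of the slice (`Σ ξ_j = 0`, `|ξ_j| ≤ 2`, `Σ |ξ_j| ≤ 2 − δ`), with `L = log T`,
`a_j = −Lξ_j`, `b_j = L|ξ_j|`, the `t`-integral of the product of the windowed zero sums,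

  `V_T(ξ) = ∫_0^T Π_j S⁺(a_j, t) dt`   (`RudnickSarnakN.slotIntegral`),

is expanded (Rudnick–Sarnak 1996, (3.19)–(3.20): "`C_n(f, h, T)` is an alternating sum of terms
`C_{r,s}(T)` … obtained from all possible choices of `r` of the factors to be `S_j^+`, `s` to be
`S_j^-` and the remaining `k = n − r − s` factors to be `g_{j,T}`") into patterns: each slot is a
density factor `g₀(b_j) ℓ(t)`, an archimedean error `O(1/(1+|t|))`, or a Dirichlet polynomial
`−𝒜(a_j, t)`. Patterns with an error factor, and the remainders of `RudnickSarnakNSlotDecomp.lean`,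
are `O(L^c T^{1−δ/2})` (damped mean values); for the main patterns, indexed by the set `D` of
density slots, the weighted mean value theorem gives `(−1)^{n−|D|} Π_{j∈D} g₀(b_j) I_{|D|}(T) 𝔖_{Dᶜ}(ξ)`
with `I_m(T) = ∫_0^T ℓ^m` and the diagonal sum

  `𝔖_S(ξ) = Σ_M (Π^*_{j ∈ S, ξ_j ≤ 0} c_{b_j})(M) · (Π^*_{j ∈ S, ξ_j > 0} c_{b_j})(M)`
  (`RudnickSarnakN.diagSum`; RS (3.33) with `M = N`),

up to `O(L^c T^{1−δ/2})` (`RudnickSarnakN.norm_slotIntegral_sub_patternSum_le`, RS (3.45)–(3.47)).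

## References

* Z. Rudnick, P. Sarnak, *Zeros of principal `L`-functions and random matrix theory*, Duke Math.
  J. 81 (1996), 269–322, (3.19)–(3.20), (3.33), (3.45)–(3.47).
-/

noncomputable section

open Complex Filter Set MeasureTheory Finset
open scoped Real Topology ComplexConjugate

namespace Literature.NumberTheory.LFunctions

namespace RudnickSarnakN

variable {k : ℕ}

/-! ## The density weight `ℓ` : derivative and integrals -/

/-- `ℓ(t) = ½ log(1/16 + t²/4) − log π`. [folklore] -/
theorem ell_eq (t : ℝ) : ell t = (1 / 2) * Real.log (1 / 16 + t ^ 2 / 4) - Real.log π := by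
  unfold ell
  congr 1
  have hsq := norm_quarter_add_sq t
  have hn : 0 ≤ ‖(1 / 4 : ℂ) + t / 2 * I‖ := norm_nonneg _
  rw [show ‖(1 / 4 : ℂ) + t / 2 * I‖ = Real.sqrt (1 / 16 + t ^ 2 / 4) by
    rw [← hsq, Real.sqrt_sq hn], Real.log_sqrt (by positivity)]
  ring

/-- The derivative `ℓ'(t) = (t/4)/(1/16 + t²/4)`. [folklore] -/
def ellDeriv (t : ℝ) : ℝ :=
  (t / 4) / (1 / 16 + t ^ 2 / 4)

/-- `HasDerivAt ℓ ℓ'(t) t`. [folklore] -/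
theorem hasDerivAt_ell (t : ℝ) : HasDerivAt ell (ellDeriv t) t := by
  have hpos : 0 < 1 / 16 + t ^ 2 / 4 := by positivity
  have h1 : HasDerivAt (fun s : ℝ ↦ 1 / 16 + s ^ 2 / 4) (2 * t / 4) t := by
    have := ((hasDerivAt_pow 2 t).div_const 4).const_add (1 / 16)
    simpa using this
  have h2 : HasDerivAt (fun s : ℝ ↦ (1 / 2) * Real.log (1 / 16 + s ^ 2 / 4) - Real.log π)
      ((1 / 2) * ((2 * t / 4) / (1 / 16 + t ^ 2 / 4))) t :=
    ((h1.log hpos.ne').const_mul (1 / 2)).sub_const _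
  have e : (fun s : ℝ ↦ (1 / 2) * Real.log (1 / 16 + s ^ 2 / 4) - Real.log π) = ell := (funext ell_eq).symm
  rw [e] at h2
  refine h2.congr_deriv ?_
  unfold ellDeriv
  field_simp

/-- `0 ≤ ℓ'(t) ≤ 1` for `t ≥ 0`. [folklore] -/
theorem ellDeriv_mem {t : ℝ} (ht : 0 ≤ t) : 0 ≤ ellDeriv t ∧ ellDeriv t ≤ 1 := by
  unfold ellDeriv
  have hpos : 0 < 1 / 16 + t ^ 2 / 4 := by positivity
  refine ⟨by positivity, ?_⟩
  rw [div_le_one hpos]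
  nlinarith [sq_nonneg (t - 1 / 2)]

/-- `ℓ'` is continuous. [folklore] -/
theorem continuous_ellDeriv : Continuous ellDeriv := by
  unfold ellDeriv
  refine Continuous.div (by fun_prop) (by fun_prop) fun t ↦ ?_
  positivity

/-- `∫_0^T ℓ' = ℓ(T) − ℓ(0)`. [folklore] -/
theorem integral_ellDeriv (T : ℝ) : ∫ t in (0 : ℝ)..T, ellDeriv t = ell T - ell 0 :=
  intervalIntegral.integral_eq_sub_of_hasDerivAt (fun t _ ↦ hasDerivAt_ell t) (continuous_ellDeriv.intervalIntegrable _ _)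

/-- `|ℓ(t)| ≤ log(T+2) + 3` on `[0, T]`. [folklore] -/
theorem abs_ell_le_of_mem {T t : ℝ} (ht : t ∈ Icc 0 T) : |ell t| ≤ Real.log (T + 2) + 3 := by
  refine (abs_ell_le t).trans ?_
  rw [abs_of_nonneg ht.1]
  have := Real.log_le_log (by linarith [ht.1]) (by linarith [ht.2] : t + 2 ≤ T + 2)
  linarith

/-- The density integrals `I_m(T) = ∫_0^T ℓ(t)^m dt`. (Rudnick–Sarnak 1996, Lemma 3.6: `κ(h) L^k`.)
[cite: RudnickSarnak1996, Lemma 3.6] -/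
def ellInt (m : ℕ) (T : ℝ) : ℝ :=
  ∫ t in (0 : ℝ)..T, ell t ^ m

/-- `∫_0^T 1/(1+t²) dt ≤ 2` (`1/(1+t²) ≤ 2/(1+t)²`). [folklore] -/
theorem integral_inv_one_add_sq_le_two {T : ℝ} (hT : 0 ≤ T) : ∫ t in (0 : ℝ)..T, 1 / (1 + t ^ 2) ≤ 2 := by
  have hG : ∀ t ∈ uIcc 0 T, HasDerivAt (fun s : ℝ ↦ -(2 * (1 + s)⁻¹)) (2 * ((1 + t) ^ 2)⁻¹) t := by
    intro t ht
    rw [uIcc_of_le hT] at ht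
    have hne : (1 + t) ≠ 0 := by have := ht.1; positivity
    have d := (((hasDerivAt_id' t).const_add 1).inv hne).const_mul 2
    exact d.neg.congr_deriv (by ring)
  have hint : IntervalIntegrable (fun t : ℝ ↦ 2 * ((1 + t) ^ 2)⁻¹) volume 0 T := by
    refine ContinuousOn.intervalIntegrable ?_
    rw [uIcc_of_le hT]
    exact ContinuousOn.mul continuousOn_const (ContinuousOn.inv₀ (by fun_prop) fun t ht ↦ by have := ht.1; positivity)
  calc ∫ t in (0 : ℝ)..T, 1 / (1 + t ^ 2) ≤ ∫ t in (0 : ℝ)..T, 2 * ((1 + t) ^ 2)⁻¹ := by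
        refine intervalIntegral.integral_mono_on hT ?_ hint fun t ht ↦ ?_
        · exact (Continuous.div continuous_const (by fun_prop) fun t ↦ by positivity).intervalIntegrable _ _
        · have h0 := ht.1
          rw [show (2 : ℝ) * ((1 + t) ^ 2)⁻¹ = 2 / (1 + t) ^ 2 by rw [div_eq_mul_inv],
            div_le_div_iff₀ (by positivity) (by positivity)]
          nlinarith [sq_nonneg (1 - t)]
    _ = -(2 * (1 + T)⁻¹) - -(2 * (1 + (0 : ℝ))⁻¹) := intervalIntegral.integral_eq_sub_of_hasDerivAt hG hint
    _ ≤ 2 := by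
        have : 0 ≤ 2 * (1 + T)⁻¹ := by positivity
        norm_num; linarith

/-! ## The slice point data -/

/-- On the slice, the non-positive coordinates carry half of the total mass:
`Σ_{ξ_j ≤ 0} |ξ_j| = Σ_{ξ_j > 0} |ξ_j| = ½ Σ |ξ_j|`. [folklore] -/
theorem sum_filter_abs_eq_half {ξ : Fin (k + 1) → ℝ} (hsum : ∑ j, ξ j = 0) :
    ∑ j ∈ Finset.univ.filter (fun j ↦ ξ j ≤ 0), |ξ j| = (∑ j, |ξ j|) / 2 ∧
      ∑ j ∈ Finset.univ.filter (fun j ↦ 0 < ξ j), |ξ j| = (∑ j, |ξ j|) / 2 := by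
  have hsplit := Finset.sum_filter_add_sum_filter_not Finset.univ (fun j ↦ ξ j ≤ 0) ξ
  have hsplit' := Finset.sum_filter_add_sum_filter_not Finset.univ (fun j ↦ ξ j ≤ 0) (fun j ↦ |ξ j|)
  have e1 : ∑ j ∈ Finset.univ.filter (fun j ↦ ξ j ≤ 0), |ξ j| = -∑ j ∈ Finset.univ.filter (fun j ↦ ξ j ≤ 0), ξ j := by
    rw [← Finset.sum_neg_distrib]
    exact Finset.sum_congr rfl fun j hj ↦ abs_of_nonpos (Finset.mem_filter.1 hj).2
  have hnot : Finset.univ.filter (fun j ↦ ¬ ξ j ≤ 0) = Finset.univ.filter (fun j ↦ 0 < ξ j) := by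
    ext j; simp
  have e2 : ∑ j ∈ Finset.univ.filter (fun j ↦ ¬ ξ j ≤ 0), |ξ j| = ∑ j ∈ Finset.univ.filter (fun j ↦ ¬ ξ j ≤ 0), ξ j :=
    Finset.sum_congr rfl fun j hj ↦ abs_of_pos (not_le.1 (Finset.mem_filter.1 hj).2)
  rw [hsum] at hsplit
  rw [← hnot]
  constructor <;> linarith

/-- The support bound of one slot is monotone in the frequency. [folklore] -/
theorem suppBound_mono {a b : ℝ} (h : a ≤ b) : suppBound a ≤ suppBound b :=
  Nat.floor_le_floor (Real.exp_le_exp.2 (by linarith))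

/-- `1 ≤ N_a` for `a ≥ 0` (`e^{a+1/4} ≥ 1`). [folklore] -/
theorem one_le_suppBound {a : ℝ} (ha : 0 ≤ a) : 1 ≤ suppBound a := by
  unfold suppBound
  rw [Nat.one_le_floor_iff]
  exact Real.one_le_exp (by linarith)

/-! ## The diagonal sums and the pattern sum -/

variable (T : ℝ) (ξ : Fin (k + 1) → ℝ)

/-- The frequencies `b_j = L |ξ_j|`. [folklore] -/
def freq (j : Fin (k + 1)) : ℝ := Real.log T * |ξ j|

/-- The `+` side of a set of Dirichlet-polynomial slots: `ξ_j ≤ 0` (`a_j = −Lξ_j ≥ 0`, `𝒜 = Σ c n^{−it}`).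
[folklore] -/
def posSide (S : Finset (Fin (k + 1))) : Finset (Fin (k + 1)) := S.filter (fun j ↦ ξ j ≤ 0)

/-- The `−` side: `ξ_j > 0` (`𝒜 = conj Σ c n^{−it}`). [folklore] -/
def negSide (S : Finset (Fin (k + 1))) : Finset (Fin (k + 1)) := S.filter (fun j ↦ 0 < ξ j)

/-- A uniform length for all Dirichlet polynomials at level `n` and height `T`: `N_{2L}^{n}`. [folklore] -/
def lenBound (k : ℕ) (T : ℝ) : ℕ := suppBound (2 * Real.log T) ^ (k + 1)

/-- **The diagonal sum of a set `S` of Dirichlet-polynomial slots**: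
`𝔖_S(ξ) = Σ_{M ≤ N_{2L}ⁿ} (Π^*_{j∈S⁺} c_{b_j})(M) (Π^*_{j∈S⁻} c_{b_j})(M)` (real, `≥ 0`).
(Rudnick–Sarnak 1996, (3.33) with `n_1⋯n_r = n_{r+1}⋯n_{r+s}`.) [cite: RudnickSarnak1996, (3.33)] -/
def diagSum (S : Finset (Fin (k + 1))) : ℝ :=
  ∑ M ∈ Finset.Icc 1 (lenBound k T), coefProd (posSide ξ S) (freq T ξ) M * coefProd (negSide ξ S) (freq T ξ) M

/-- The `t`-integral of the slot product at the slice point `ξ`: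
`V_T(ξ) = ∫_0^T Π_j S⁺(−Lξ_j, t) dt`. [cite: RudnickSarnak1996, (3.11)] -/
def slotIntegral : ℂ :=
  ∫ t in (0 : ℝ)..T, ∏ j, zeroSumPlus (-(Real.log T * ξ j)) t

/-- **The pattern sum** (main terms): over the sets `D` of density slots,
`Σ_D (−1)^{n−|D|} (Π_{j∈D} g₀(b_j)) I_{|D|}(T) 𝔖_{Dᶜ}(ξ)`. [cite: RudnickSarnak1996, (3.19)–(3.20)] -/
def patternSum : ℂ :=
  ∑ D ∈ (Finset.univ : Finset (Fin (k + 1))).powerset,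
    (-1 : ℂ) ^ (Finset.univ \ D).card * ((∏ j ∈ D, (g0 (freq T ξ j)).re : ℝ) : ℂ) *
      (ellInt D.card T : ℂ) * (diagSum T ξ (Finset.univ \ D) : ℂ)

variable {T ξ}

/-! ## The three kinds of factors and their continuity -/

/-- The archimedean error of one slot, `e(a, t) := 𝒟(a, t) − g₀(a) ℓ(t)`. [folklore] -/
def archErr (a t : ℝ) : ℂ := archTerm a t - g0 a * (ell t : ℂ)

/-- `‖e(a, t)‖ ≤ archErrConst/(1+|t|)`. [cite: RudnickSarnak1996, Lemma 3.1] -/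
theorem norm_archErr_le (a t : ℝ) : ‖archErr a t‖ ≤ archErrConst / (1 + |t|) := norm_archTerm_sub_le a t

/-- `B = g₀(a) ℓ + e − 𝒜`. [folklore] -/
theorem slotB_eq (a t : ℝ) : slotB a t = g0 a * (ell t : ℂ) + (archErr a t - primePoly a t) := by
  unfold slotB archErr; ring

/-- Continuity of `t ↦ e(a, t)`. [folklore] -/
theorem continuous_archErr (a : ℝ) : Continuous (archErr a) := by
  unfold archErr
  exact (continuous_archTerm a).sub (continuous_const.mul (Complex.continuous_ofReal.comp continuous_ell))

/-! ## Step 1: the remainders (`E₁`) -/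

/-- `|−Lξ_j| = b_j` for `T ≥ 1`. [folklore] -/
theorem abs_neg_log_mul (hT : 1 ≤ T) (j : Fin (k + 1)) : |-(Real.log T * ξ j)| = freq T ξ j := by
  rw [abs_neg, abs_mul, abs_of_nonneg (Real.log_nonneg hT)]; rfl

/-- `log(t+2) ≤ log T + 1` for `0 ≤ t ≤ T`, `T ≥ 2`. [folklore] -/
theorem log_add_two_le (hT : 2 ≤ T) {t : ℝ} (ht : t ∈ Icc 0 T) : Real.log (t + 2) ≤ Real.log T + 1 := by
  have h1 : Real.log (t + 2) ≤ Real.log (2 * T) := Real.log_le_log (by linarith [ht.1]) (by linarith [ht.2])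
  rw [Real.log_mul (by norm_num) (by linarith)] at h1
  linarith [Real.log_two_lt_d9]

/-- **`E₁`**: for `T ≥ 2` and `Σ ξ_j = 0` (RH),
`‖V_T(ξ) − ∫_0^T Π_j B(a_j, t) dt‖ ≤ 2ⁿ⁺¹ Kⁿ (log T + 2)ⁿ e^{Σ b_j/2}`. [cite: RudnickSarnak1996, (3.15)] -/
theorem norm_slotIntegral_sub_integral_prod_slotB_le (hRH : RiemannHypothesis) (hT : 2 ≤ T)
    (hsum : ∑ j, ξ j = 0) :
    ‖slotIntegral T ξ - ∫ t in (0 : ℝ)..T, ∏ j, slotB (-(Real.log T * ξ j)) t‖ ≤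
      2 ^ (k + 1) * (max (max slotBConst remConst) 1 * (Real.log T + 2)) ^ (k + 1) *
        Real.exp ((∑ j, freq T ξ j) / 2) * 2 := by
  have hT0 : (0 : ℝ) ≤ T := by linarith
  have hT1 : (1 : ℝ) ≤ T := by linarith
  set L := Real.log T
  set a : Fin (k + 1) → ℝ := fun j ↦ -(L * ξ j)
  have ha : ∑ j, a j = 0 := by
    simp only [a]
    rw [Finset.sum_neg_distrib, ← Finset.mul_sum, hsum, mul_zero, neg_zero]
  have hab : ∀ j, |a j| = freq T ξ j := fun j ↦ abs_neg_log_mul hT1 j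
  set Kc : ℝ := max (max slotBConst remConst) 1
  have hKc : 0 ≤ Kc := zero_le_one.trans (le_max_right _ _)
  set C₀ : ℝ := 2 ^ (k + 1) * (Kc * (L + 2)) ^ (k + 1) * Real.exp ((∑ j, freq T ξ j) / 2)
  have hC₀ : 0 ≤ C₀ := by
    have : 0 ≤ L := Real.log_nonneg hT1
    positivity
  have hi1 : IntervalIntegrable (fun t ↦ ∏ j, zeroSumPlus (a j) t) volume 0 T :=
    (continuous_finsetProd _ fun j _ ↦ continuous_zeroSumPlus (a j)).intervalIntegrable _ _
  have hi2 : IntervalIntegrable (fun t ↦ ∏ j, slotB (a j) t) volume 0 T :=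
    (continuous_finsetProd _ fun j _ ↦ continuous_slotB (a j)).intervalIntegrable _ _
  unfold slotIntegral
  rw [← intervalIntegral.integral_sub hi1 hi2]
  calc ‖∫ t in (0 : ℝ)..T, (∏ j, zeroSumPlus (a j) t - ∏ j, slotB (a j) t)‖
      ≤ ∫ t in (0 : ℝ)..T, ‖∏ j, zeroSumPlus (a j) t - ∏ j, slotB (a j) t‖ :=
        intervalIntegral.norm_integral_le_integral_norm hT0
    _ ≤ ∫ t in (0 : ℝ)..T, C₀ * (1 / (1 + t ^ 2)) := by
        refine intervalIntegral.integral_mono_on hT0 (hi1.sub hi2).norm ?_ fun t ht ↦ ?_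
        · exact (continuous_const.mul (Continuous.div continuous_const (by fun_prop) fun t ↦ by positivity)).intervalIntegrable _ _
        · refine (norm_prod_zeroSumPlus_sub_prod_slotB_le hRH a ha ht.1).trans ?_
          rw [mul_one_div]
          refine div_le_div_of_nonneg_right ?_ (by positivity)
          have e : (∑ j, |a j|) / 2 = (∑ j, freq T ξ j) / 2 := by simp_rw [hab]
          rw [e]
          simp only [C₀]
          have hlog := log_add_two_le hT ht
          have hlog0 : 0 ≤ Real.log (t + 2) := Real.log_nonneg (by linarith [ht.1])
          have hle : Kc * (Real.log (t + 2) + 1) ≤ Kc * (L + 2) := mul_le_mul_of_nonneg_left (by linarith) hKc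
          have h0 : 0 ≤ Kc * (Real.log (t + 2) + 1) := by positivity
          exact mul_le_mul_of_nonneg_right (mul_le_mul_of_nonneg_left (pow_le_pow_left₀ h0 hle _) (by positivity))
            (by positivity)
    _ = C₀ * ∫ t in (0 : ℝ)..T, 1 / (1 + t ^ 2) := by rw [intervalIntegral.integral_const_mul]
    _ ≤ C₀ * 2 := mul_le_mul_of_nonneg_left (integral_inv_one_add_sq_le_two hT0) hC₀

/-! ## Step 2: expanding the product of the `B`'s into patterns -/

/-- **Pointwise pattern expansion**: with `D_j = g₀(a_j) ℓ(t)`, `e_j`, `𝒜_j`,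
`Π_j B(a_j,t) = Σ_{D} (Π_{j∈D} g₀(a_j)) ℓ(t)^{|D|} Σ_{A' ⊆ Dᶜ} (Π_{j∈A'} (−𝒜_j)) Π_{j ∈ Dᶜ∖A'} e_j`.
[cite: RudnickSarnak1996, (3.19)–(3.20)] -/
theorem prod_slotB_eq (a : Fin (k + 1) → ℝ) (t : ℝ) :
    ∏ j, slotB (a j) t =
      ∑ D ∈ (Finset.univ : Finset (Fin (k + 1))).powerset,
        (∏ j ∈ D, g0 (a j)) * (ell t : ℂ) ^ D.card *
          ∑ A' ∈ (Finset.univ \ D).powerset,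
            (∏ j ∈ A', (-primePoly (a j) t)) * ∏ j ∈ (Finset.univ \ D) \ A', archErr (a j) t := by
  classical
  have e1 : ∏ j, slotB (a j) t = ∏ j, (g0 (a j) * (ell t : ℂ) + (-primePoly (a j) t + archErr (a j) t)) :=
    Finset.prod_congr rfl fun j _ ↦ by rw [slotB_eq]; ring
  rw [e1, Finset.prod_add]
  refine Finset.sum_congr rfl fun D _ ↦ ?_
  rw [Finset.prod_mul_distrib, Finset.prod_const, Finset.prod_add]

/-- The complement of the `+` side within `S` is the `−` side. [folklore] -/
theorem filter_not_posSide (S : Finset (Fin (k + 1))) :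
    S.filter (fun j ↦ ¬ ξ j ≤ 0) = negSide ξ S := by
  unfold negSide; ext j; simp [not_le]

/-- **The product of the Dirichlet-polynomial slots as two Dirichlet polynomials**: for `T ≥ 1`,
`Π_{j∈S} 𝒜(−Lξ_j, t) = F⁺_S(t) · conj F⁻_S(t)` with `F^±_S` the Dirichlet polynomial of
`coefProd (S^±) b`. [cite: RudnickSarnak1996, (3.33)] -/
theorem prod_primePoly_eq (hT : 1 ≤ T) (S : Finset (Fin (k + 1))) (t : ℝ) :
    ∏ j ∈ S, primePoly (-(Real.log T * ξ j)) t =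
      dirPoly (∏ j ∈ posSide ξ S, suppBound (freq T ξ j)) (fun n ↦ ((coefProd (posSide ξ S) (freq T ξ) n : ℝ) : ℂ)) t *
        conj (dirPoly (∏ j ∈ negSide ξ S, suppBound (freq T ξ j)) (fun n ↦ ((coefProd (negSide ξ S) (freq T ξ) n : ℝ) : ℂ)) t) := by
  classical
  have hL : 0 ≤ Real.log T := Real.log_nonneg hT
  rw [← Finset.prod_filter_mul_prod_filter_not S (fun j ↦ ξ j ≤ 0), filter_not_posSide]
  congr 1
  · rw [dirPoly_coefProd]
    refine Finset.prod_congr rfl fun j hj ↦ ?_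
    have hξ : ξ j ≤ 0 := (Finset.mem_filter.1 hj).2
    have ha : 0 ≤ -(Real.log T * ξ j) := by nlinarith
    rw [primePoly_eq_dirPoly ha]
    have : -(Real.log T * ξ j) = freq T ξ j := by
      unfold freq; rw [abs_of_nonpos hξ]; ring
    rw [this]
  · rw [dirPoly_coefProd, map_prod]
    refine Finset.prod_congr rfl fun j hj ↦ ?_
    have hξ : 0 < ξ j := (Finset.mem_filter.1 hj).2
    have ha : -(Real.log T * ξ j) ≤ 0 := by nlinarith
    rw [primePoly_eq_conj_dirPoly ha]
    have : -(-(Real.log T * ξ j)) = freq T ξ j := by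
      unfold freq; rw [abs_of_pos hξ]; ring
    rw [this]

/-- Length enlargement: `Σ_{n ≤ N} a_n n^{−it} = Σ_{n ≤ N'} a_n n^{−it}` if `a_n = 0` for `N < n`, `N ≤ N'`.
[folklore] -/
theorem dirPoly_eq_of_le {N N' : ℕ} (hNN' : N ≤ N') (a : ℕ → ℂ) (ha : ∀ n, N < n → a n = 0) (t : ℝ) :
    dirPoly N a t = dirPoly N' a t := by
  unfold dirPoly
  refine Finset.sum_subset (Finset.Icc_subset_Icc_right hNN') fun n hn hn' ↦ ?_
  rw [Finset.mem_Icc] at hn hn'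
  rw [ha n (by omega), zero_mul]

/-! ## Sizes of the two Dirichlet polynomials -/

/-- On the slice with `Σ |ξ_j| ≤ 2 − δ`: `Σ_{j ∈ S⁺} b_j ≤ L (1 − δ/2)` and the same for `S⁻` (`T ≥ 1`).
[folklore] -/
theorem sum_freq_side_le (hT : 1 ≤ T) (hsum : ∑ j, ξ j = 0) {δ : ℝ} (hδ : ∑ j, |ξ j| ≤ 2 - δ)
    (S : Finset (Fin (k + 1))) :
    ∑ j ∈ posSide ξ S, freq T ξ j ≤ Real.log T * (1 - δ / 2) ∧
      ∑ j ∈ negSide ξ S, freq T ξ j ≤ Real.log T * (1 - δ / 2) := by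
  have hL : 0 ≤ Real.log T := Real.log_nonneg hT
  obtain ⟨hp, hn⟩ := sum_filter_abs_eq_half hsum
  have hsub1 : posSide ξ S ⊆ Finset.univ.filter (fun j ↦ ξ j ≤ 0) := Finset.filter_subset_filter _ (Finset.subset_univ S)
  have hsub2 : negSide ξ S ⊆ Finset.univ.filter (fun j ↦ 0 < ξ j) := Finset.filter_subset_filter _ (Finset.subset_univ S)
  unfold freq
  rw [← Finset.mul_sum, ← Finset.mul_sum]
  constructor
  · refine mul_le_mul_of_nonneg_left ?_ hL
    calc ∑ j ∈ posSide ξ S, |ξ j| ≤ ∑ j ∈ Finset.univ.filter (fun j ↦ ξ j ≤ 0), |ξ j| :=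
          Finset.sum_le_sum_of_subset_of_nonneg hsub1 fun _ _ _ ↦ abs_nonneg _
      _ = (∑ j, |ξ j|) / 2 := hp
      _ ≤ 1 - δ / 2 := by linarith
  · refine mul_le_mul_of_nonneg_left ?_ hL
    calc ∑ j ∈ negSide ξ S, |ξ j| ≤ ∑ j ∈ Finset.univ.filter (fun j ↦ 0 < ξ j), |ξ j| :=
          Finset.sum_le_sum_of_subset_of_nonneg hsub2 fun _ _ _ ↦ abs_nonneg _
      _ = (∑ j, |ξ j|) / 2 := hn
      _ ≤ 1 - δ / 2 := by linarith

/-- **The lengths are `≤ e^{n/4} T^{1−δ/2}`**: for `S' ⊆` one side,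
`Π_{j∈S'} N_{b_j} ≤ exp(Σ_{S'} b_j + |S'|/4)`. [folklore] -/
theorem prod_suppBound_le (S' : Finset (Fin (k + 1))) :
    ((∏ j ∈ S', suppBound (freq T ξ j) : ℕ) : ℝ) ≤ Real.exp (∑ j ∈ S', freq T ξ j + S'.card / 4) := by
  push_cast
  rw [Real.exp_add, Real.exp_sum, show Real.exp (S'.card / 4 : ℝ) = ∏ _j ∈ S', Real.exp (1 / 4) by
    rw [Finset.prod_const, ← Real.exp_nat_mul]; congr 1; ring, ← Finset.prod_mul_distrib]
  refine Finset.prod_le_prod (fun j _ ↦ Nat.cast_nonneg _) fun j _ ↦ ?_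
  rw [← Real.exp_add]
  exact suppBound_le _

/-- For `T ≥ 1`, `exp(L c) = T^c`. [folklore] -/
theorem exp_log_mul_eq_rpow (hT : 1 ≤ T) (c : ℝ) : Real.exp (Real.log T * c) = T ^ c :=
  (Real.rpow_def_of_pos (by linarith) c).symm

/-- The side lengths: `Π_{S⁺} N_{b_j} ≤ e^{n/4} T^{1−δ/2}` (and for `S⁻`). [folklore] -/
theorem prod_suppBound_side_le (hT : 1 ≤ T) (hsum : ∑ j, ξ j = 0) {δ : ℝ} (hδ : ∑ j, |ξ j| ≤ 2 - δ)
    (S : Finset (Fin (k + 1))) :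
    ((∏ j ∈ posSide ξ S, suppBound (freq T ξ j) : ℕ) : ℝ) ≤ Real.exp ((k + 1) / 4) * T ^ (1 - δ / 2) ∧
      ((∏ j ∈ negSide ξ S, suppBound (freq T ξ j) : ℕ) : ℝ) ≤ Real.exp ((k + 1) / 4) * T ^ (1 - δ / 2) := by
  obtain ⟨hp, hn⟩ := sum_freq_side_le hT hsum hδ S
  have hcard : ∀ S' : Finset (Fin (k + 1)), (S'.card : ℝ) / 4 ≤ (k + 1) / 4 := fun S' ↦ by
    have := S'.card_le_univ; rw [Fintype.card_fin] at this
    exact div_le_div_of_nonneg_right (by exact_mod_cast this) (by norm_num)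
  constructor
  · refine (prod_suppBound_le _).trans ?_
    rw [← exp_log_mul_eq_rpow hT, ← Real.exp_add]
    exact Real.exp_le_exp.2 (by linarith [hcard (posSide ξ S)])
  · refine (prod_suppBound_le _).trans ?_
    rw [← exp_log_mul_eq_rpow hT, ← Real.exp_add]
    exact Real.exp_le_exp.2 (by linarith [hcard (negSide ξ S)])

/-- The side lengths are at most the uniform length `N_{2L}ⁿ` (`|ξ_j| ≤ 2`). [folklore] -/
theorem prod_suppBound_le_lenBound (hT : 1 ≤ T) (hbox : ∀ j, |ξ j| ≤ 2) (S' : Finset (Fin (k + 1))) :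
    ∏ j ∈ S', suppBound (freq T ξ j) ≤ lenBound k T := by
  have hL : 0 ≤ Real.log T := Real.log_nonneg hT
  have h1 : ∀ j ∈ S', suppBound (freq T ξ j) ≤ suppBound (2 * Real.log T) := fun j _ ↦
    suppBound_mono (by unfold freq; nlinarith [hbox j, abs_nonneg (ξ j)])
  calc ∏ j ∈ S', suppBound (freq T ξ j) ≤ ∏ _j ∈ S', suppBound (2 * Real.log T) := Finset.prod_le_prod' h1
    _ = suppBound (2 * Real.log T) ^ S'.card := Finset.prod_const _
    _ ≤ suppBound (2 * Real.log T) ^ (k + 1) := by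
        refine Nat.pow_le_pow_right (one_le_suppBound (by positivity)) ?_
        have := S'.card_le_univ; rwa [Fintype.card_fin] at this

/-- The square-sum constant `SQ = (max 1 (C₂ (L + n)))ⁿ`, `C₂ = ∫φ · C₁ · e^{1/8}`. [folklore] -/
def sqConst (k : ℕ) (T : ℝ) : ℝ :=
  (max 1 (bumpMass * coefL1Const * Real.exp (1 / 8) * (Real.log T + (k + 1)))) ^ (k + 1)

/-- `1 ≤ SQ`. [folklore] -/
theorem one_le_sqConst (k : ℕ) (T : ℝ) : 1 ≤ sqConst k T := one_le_pow₀ (le_max_left _ _)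

/-- **Square sums of the side coefficients**: for `S' =` a side of `S` (so `Σ_{S'} b_j ≤ L`, `T ≥ 1`),
with `N' = Π_{S'} N_{b_j}`: `Σ_{n ≤ N'} (coefProd S' b)(n)² ≤ SQ` and `Σ_{n ≤ N'} n (coefProd S' b)(n)² ≤ N' SQ`.
[cite: RudnickSarnak1996, Lemma 3.5] -/
theorem sum_sq_side_le (hT : 1 ≤ T) (S' : Finset (Fin (k + 1))) (hS' : ∑ j ∈ S', freq T ξ j ≤ Real.log T) :
    ∑ n ∈ Finset.Icc 1 (∏ j ∈ S', suppBound (freq T ξ j)), coefProd S' (freq T ξ) n ^ 2 ≤ sqConst k T ∧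
      ∑ n ∈ Finset.Icc 1 (∏ j ∈ S', suppBound (freq T ξ j)), (n : ℝ) * coefProd S' (freq T ξ) n ^ 2 ≤
        (∏ j ∈ S', suppBound (freq T ξ j) : ℕ) * sqConst k T := by
  classical
  have hL : 0 ≤ Real.log T := Real.log_nonneg hT
  set N' := ∏ j ∈ S', suppBound (freq T ξ j)
  rcases S'.eq_empty_or_nonempty with hS | hS
  · subst hS
    simp only [Finset.prod_empty, N', coefProd_empty]
    rw [show Finset.Icc 1 1 = {1} by rfl, Finset.sum_singleton, Finset.sum_singleton, ArithmeticFunction.one_apply,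
      if_pos rfl]
    simp only [one_pow, Nat.cast_one, one_mul]
    exact ⟨one_le_sqConst k T, one_le_sqConst k T⟩
  · have h1 := sum_sq_coefProd_le hS (freq T ξ) N'
    have h2 := sum_mul_sq_coefProd_le hS (freq T ξ) N'
    have hlogN : Real.log N' ≤ Real.log T + (k + 1) := by
      have hN1 : (1 : ℝ) ≤ N' := by
        have : 1 ≤ N' := Finset.one_le_prod' fun j _ ↦ one_le_suppBound (by unfold freq; positivity)
        exact_mod_cast this
      have hNle := prod_suppBound_le (T := T) (ξ := ξ) S'
      have hcard : (S'.card : ℝ) / 4 ≤ (k + 1) := by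
        have := S'.card_le_univ; rw [Fintype.card_fin] at this
        have : (S'.card : ℝ) ≤ k + 1 := by exact_mod_cast this
        linarith [S'.card.cast_nonneg (α := ℝ)]
      calc Real.log N' ≤ Real.log (Real.exp (∑ j ∈ S', freq T ξ j + S'.card / 4)) := Real.log_le_log (by linarith) hNle
        _ = ∑ j ∈ S', freq T ξ j + S'.card / 4 := Real.log_exp _
        _ ≤ Real.log T + (k + 1) := by linarith
    have hbase : bumpMass * coefL1Const * Real.exp (1 / 8) * Real.log N' ≤
        max 1 (bumpMass * coefL1Const * Real.exp (1 / 8) * (Real.log T + (k + 1))) := by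
      refine le_trans ?_ (le_max_right _ _)
      have := bumpMass_pos; have := coefL1Const_pos
      exact mul_le_mul_of_nonneg_left hlogN (by positivity)
    have hbase0 : 0 ≤ bumpMass * coefL1Const * Real.exp (1 / 8) * Real.log N' := by
      have := bumpMass_pos; have := coefL1Const_pos
      have : 0 ≤ Real.log (N' : ℝ) := Real.log_natCast_nonneg _
      positivity
    have hpow : (bumpMass * coefL1Const * Real.exp (1 / 8) * Real.log N') ^ S'.card ≤ sqConst k T := by
      unfold sqConst
      calc (bumpMass * coefL1Const * Real.exp (1 / 8) * Real.log N') ^ S'.card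
          ≤ (max 1 (bumpMass * coefL1Const * Real.exp (1 / 8) * (Real.log T + (k + 1)))) ^ S'.card :=
            pow_le_pow_left₀ hbase0 hbase _
        _ ≤ _ := by
            refine pow_le_pow_right₀ (le_max_left _ _) ?_
            have := S'.card_le_univ; rwa [Fintype.card_fin] at this
    exact ⟨h1.trans hpow, h2.trans (mul_le_mul_of_nonneg_left hpow (Nat.cast_nonneg _))⟩

/-! ## Step 3: patterns with an archimedean error factor (`E₂`) -/

/-- `|ℓ(t)|^m ≤ (log T + 4)^m` on `[0, T]`, `T ≥ 2`. [folklore] -/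
theorem abs_ell_pow_le (hT : 2 ≤ T) {t : ℝ} (ht : t ∈ Icc 0 T) (m : ℕ) : |ell t| ^ m ≤ (Real.log T + 4) ^ m := by
  refine pow_le_pow_left₀ (abs_nonneg _) ?_ m
  have h1 := abs_ell_le_of_mem ht
  have h2 := log_add_two_le hT (t := T) ⟨by linarith, le_rfl⟩
  linarith

/-- `log(1+T) ≤ log T + 1` for `T ≥ 2`. [folklore] -/
theorem log_one_add_le (hT : 2 ≤ T) : Real.log (1 + T) ≤ Real.log T + 1 := by
  have := log_add_two_le hT (t := T) ⟨by linarith, le_rfl⟩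
  have h2 : Real.log (1 + T) ≤ Real.log (T + 2) := Real.log_le_log (by linarith) (by linarith)
  linarith

/-- The damped mean square of a side polynomial: for a side `S'` (`Σ_{S'} b_j ≤ L(1−δ/2)`),
`∫_0^T ‖F_{S'}(t)‖²/(1+t) dt ≤ (36 e^{n/4} T^{1−δ/2} + 5 + 5(log T + 1)) SQ`. [cite: RudnickSarnak1996, Lemma 3.5] -/
theorem integral_norm_sq_side_div_le (hT : 2 ≤ T) {δ : ℝ} (hδ : 0 ≤ δ) (S' : Finset (Fin (k + 1)))
    (hS' : ∑ j ∈ S', freq T ξ j ≤ Real.log T * (1 - δ / 2)) :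
    ∫ t in (0 : ℝ)..T, ‖dirPoly (∏ j ∈ S', suppBound (freq T ξ j))
        (fun n ↦ ((coefProd S' (freq T ξ) n : ℝ) : ℂ)) t‖ ^ 2 / (1 + t) ≤
      (36 * (Real.exp ((k + 1) / 4) * T ^ (1 - δ / 2)) + 5 + 5 * (Real.log T + 1)) * sqConst k T := by
  have hT0 : (0 : ℝ) ≤ T := by linarith
  have hT1 : (1 : ℝ) ≤ T := by linarith
  have hL : 0 ≤ Real.log T := Real.log_nonneg hT1
  set N' := ∏ j ∈ S', suppBound (freq T ξ j)
  have h1 := integral_norm_sq_dirPoly_div_le N' (fun n ↦ ((coefProd S' (freq T ξ) n : ℝ) : ℂ)) hT0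
  have hsq : ∑ n ∈ Finset.Icc 1 N', ‖((coefProd S' (freq T ξ) n : ℝ) : ℂ)‖ ^ 2 =
      ∑ n ∈ Finset.Icc 1 N', coefProd S' (freq T ξ) n ^ 2 :=
    Finset.sum_congr rfl fun n _ ↦ by rw [Complex.norm_real, Real.norm_eq_abs, sq_abs]
  rw [hsq] at h1
  have hS'L : ∑ j ∈ S', freq T ξ j ≤ Real.log T := hS'.trans (by nlinarith)
  obtain ⟨hA, -⟩ := sum_sq_side_le (ξ := ξ) hT1 S' hS'L
  have hN' : (N' : ℝ) ≤ Real.exp ((k + 1) / 4) * T ^ (1 - δ / 2) := by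
    refine (prod_suppBound_le _).trans ?_
    rw [← exp_log_mul_eq_rpow hT1, ← Real.exp_add]
    refine Real.exp_le_exp.2 ?_
    have := S'.card_le_univ; rw [Fintype.card_fin] at this
    have : (S'.card : ℝ) ≤ k + 1 := by exact_mod_cast this
    linarith
  have hlog := log_one_add_le hT
  have hSQ := one_le_sqConst k T
  have hsum0 : 0 ≤ ∑ n ∈ Finset.Icc 1 N', coefProd S' (freq T ξ) n ^ 2 := Finset.sum_nonneg fun _ _ ↦ sq_nonneg _
  refine h1.trans ?_
  have hc0 : 0 ≤ 36 * (N' : ℝ) + 5 + 5 * Real.log (1 + T) := by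
    have : 0 ≤ Real.log (1 + T) := Real.log_nonneg (by linarith)
    positivity
  calc (36 * (N' : ℝ) + 5 + 5 * Real.log (1 + T)) * ∑ n ∈ Finset.Icc 1 N', coefProd S' (freq T ξ) n ^ 2
      ≤ (36 * (N' : ℝ) + 5 + 5 * Real.log (1 + T)) * sqConst k T := mul_le_mul_of_nonneg_left hA hc0
    _ ≤ _ := by
        refine mul_le_mul_of_nonneg_right ?_ (by linarith)
        linarith

/-- **`E₂` (one pattern with an archimedean error factor)**: for `E ≠ ∅`,
`‖∫_0^T ℓ(t)^m (Π_{j∈A'} (−𝒜_j)) (Π_{j∈E} e_j) dt‖ ≤ (log T+4)^m (max C_𝒟 1)ⁿ (36 e^{n/4}T^{1−δ/2} + 5L + 10) SQ`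
(damped mean values and `2|F⁺||F⁻| ≤ |F⁺|² + |F⁻|²`). [cite: RudnickSarnak1996, (3.45)–(3.47)] -/
theorem norm_integral_errPattern_le (hT : 2 ≤ T) (hsum : ∑ j, ξ j = 0) {δ : ℝ} (hδ0 : 0 ≤ δ)
    (hδ : ∑ j, |ξ j| ≤ 2 - δ) (A' E : Finset (Fin (k + 1))) (hE : E.Nonempty) (m : ℕ) :
    ‖∫ t in (0 : ℝ)..T, (ell t : ℂ) ^ m *
        ((∏ j ∈ A', -primePoly (-(Real.log T * ξ j)) t) * ∏ j ∈ E, archErr (-(Real.log T * ξ j)) t)‖ ≤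
      (Real.log T + 4) ^ m * (max archErrConst 1) ^ (k + 1) *
        ((36 * (Real.exp ((k + 1) / 4) * T ^ (1 - δ / 2)) + 5 + 5 * (Real.log T + 1)) * sqConst k T) := by
  classical
  have hT0 : (0 : ℝ) ≤ T := by linarith
  have hT1 : (1 : ℝ) ≤ T := by linarith
  have hL : 0 ≤ Real.log T := Real.log_nonneg hT1
  set L := Real.log T
  set AE : ℝ := max archErrConst 1
  have hAE1 : 1 ≤ AE := le_max_right _ _
  set N1 := ∏ j ∈ posSide ξ A', suppBound (freq T ξ j)
  set N2 := ∏ j ∈ negSide ξ A', suppBound (freq T ξ j)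
  set F1 : ℝ → ℂ := fun t ↦ dirPoly N1 (fun n ↦ ((coefProd (posSide ξ A') (freq T ξ) n : ℝ) : ℂ)) t
  set F2 : ℝ → ℂ := fun t ↦ dirPoly N2 (fun n ↦ ((coefProd (negSide ξ A') (freq T ξ) n : ℝ) : ℂ)) t
  have hF1c : Continuous F1 := continuous_dirPoly _ _
  have hF2c : Continuous F2 := continuous_dirPoly _ _
  -- pointwise bound on `[0, T]`
  set g : ℝ → ℝ := fun t ↦ (L + 4) ^ m * AE ^ (k + 1) * (1 / 2) * (‖F1 t‖ ^ 2 / (1 + t) + ‖F2 t‖ ^ 2 / (1 + t))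
  have hpt : ∀ t ∈ Icc 0 T, ‖(ell t : ℂ) ^ m *
      ((∏ j ∈ A', -primePoly (-(L * ξ j)) t) * ∏ j ∈ E, archErr (-(L * ξ j)) t)‖ ≤ g t := by
    intro t ht
    have ht0 : 0 ≤ t := ht.1
    have hA : ‖∏ j ∈ A', -primePoly (-(L * ξ j)) t‖ = ‖F1 t‖ * ‖F2 t‖ := by
      rw [norm_prod]
      have : ∏ j ∈ A', ‖-primePoly (-(L * ξ j)) t‖ = ‖∏ j ∈ A', primePoly (-(L * ξ j)) t‖ := by
        rw [norm_prod]; exact Finset.prod_congr rfl fun j _ ↦ norm_neg _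
      rw [this, prod_primePoly_eq hT1, norm_mul, Complex.norm_conj]
    have hEb : ‖∏ j ∈ E, archErr (-(L * ξ j)) t‖ ≤ AE ^ (k + 1) * (1 / (1 + t)) := by
      rw [norm_prod]
      have h1 : ∏ j ∈ E, ‖archErr (-(L * ξ j)) t‖ ≤ ∏ _j ∈ E, AE * (1 / (1 + t)) := by
        refine Finset.prod_le_prod (fun j _ ↦ norm_nonneg _) fun j _ ↦ ?_
        refine (norm_archErr_le _ _).trans ?_
        rw [abs_of_nonneg ht0, mul_one_div]
        exact div_le_div_of_nonneg_right (le_max_left _ _) (by linarith)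
      refine h1.trans ?_
      rw [Finset.prod_const, mul_pow]
      have hc : 1 ≤ E.card := Finset.card_pos.2 hE
      have hc' : E.card ≤ k + 1 := by have := E.card_le_univ; rwa [Fintype.card_fin] at this
      have hx0 : 0 ≤ 1 / (1 + t) := by positivity
      have hx1 : 1 / (1 + t) ≤ 1 := by rw [div_le_one (by linarith)]; linarith
      calc AE ^ E.card * (1 / (1 + t)) ^ E.card ≤ AE ^ (k + 1) * (1 / (1 + t)) ^ 1 :=
            mul_le_mul (pow_le_pow_right₀ hAE1 hc') (pow_le_pow_of_le_one hx0 hx1 hc) (by positivity) (by positivity)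
        _ = AE ^ (k + 1) * (1 / (1 + t)) := by rw [pow_one]
    rw [norm_mul, norm_mul, norm_pow, Complex.norm_real, Real.norm_eq_abs, hA]
    have hellm := abs_ell_pow_le hT ht m
    have hamgm : ‖F1 t‖ * ‖F2 t‖ ≤ (1 / 2) * (‖F1 t‖ ^ 2 + ‖F2 t‖ ^ 2) := by nlinarith [sq_nonneg (‖F1 t‖ - ‖F2 t‖)]
    have h12 : 0 ≤ ‖F1 t‖ * ‖F2 t‖ := by positivity
    calc |ell t| ^ m * (‖F1 t‖ * ‖F2 t‖ * ‖∏ j ∈ E, archErr (-(L * ξ j)) t‖)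
        ≤ (L + 4) ^ m * (‖F1 t‖ * ‖F2 t‖ * (AE ^ (k + 1) * (1 / (1 + t)))) :=
          mul_le_mul hellm (mul_le_mul_of_nonneg_left hEb h12) (by positivity) (by positivity)
      _ ≤ (L + 4) ^ m * ((1 / 2) * (‖F1 t‖ ^ 2 + ‖F2 t‖ ^ 2) * (AE ^ (k + 1) * (1 / (1 + t)))) := by
          refine mul_le_mul_of_nonneg_left (mul_le_mul_of_nonneg_right hamgm (by positivity)) (by positivity)
      _ = g t := by simp only [g]; field_simp
  -- integrate
  have hcontH : Continuous fun t ↦ (ell t : ℂ) ^ m *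
      ((∏ j ∈ A', -primePoly (-(L * ξ j)) t) * ∏ j ∈ E, archErr (-(L * ξ j)) t) := by
    refine ((Complex.continuous_ofReal.comp continuous_ell).pow m).mul (Continuous.mul ?_ ?_)
    · exact continuous_finsetProd _ fun j _ ↦ (continuous_primePoly _).neg
    · exact continuous_finsetProd _ fun j _ ↦ continuous_archErr _
  have hgi : IntervalIntegrable g volume 0 T := by
    refine ContinuousOn.intervalIntegrable ?_
    rw [uIcc_of_le hT0]
    refine ContinuousOn.mul continuousOn_const (ContinuousOn.add ?_ ?_)
    · exact ContinuousOn.div (hF1c.norm.pow 2).continuousOn (by fun_prop) fun t ht ↦ by have := ht.1; positivity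
    · exact ContinuousOn.div (hF2c.norm.pow 2).continuousOn (by fun_prop) fun t ht ↦ by have := ht.1; positivity
  obtain ⟨hpos, hneg⟩ := sum_freq_side_le hT1 hsum hδ A'
  have hJ1 := integral_norm_sq_side_div_le (ξ := ξ) hT hδ0 (posSide ξ A') hpos
  have hJ2 := integral_norm_sq_side_div_le (ξ := ξ) hT hδ0 (negSide ξ A') hneg
  set Q : ℝ := (36 * (Real.exp ((k + 1) / 4) * T ^ (1 - δ / 2)) + 5 + 5 * (L + 1)) * sqConst k T
  calc ‖∫ t in (0 : ℝ)..T, (ell t : ℂ) ^ m * ((∏ j ∈ A', -primePoly (-(L * ξ j)) t) * ∏ j ∈ E, archErr (-(L * ξ j)) t)‖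
      ≤ ∫ t in (0 : ℝ)..T, ‖(ell t : ℂ) ^ m * ((∏ j ∈ A', -primePoly (-(L * ξ j)) t) * ∏ j ∈ E, archErr (-(L * ξ j)) t)‖ :=
        intervalIntegral.norm_integral_le_integral_norm hT0
    _ ≤ ∫ t in (0 : ℝ)..T, g t :=
        intervalIntegral.integral_mono_on hT0 (hcontH.norm.intervalIntegrable _ _) hgi hpt
    _ = (L + 4) ^ m * AE ^ (k + 1) * (1 / 2) *
          ((∫ t in (0 : ℝ)..T, ‖F1 t‖ ^ 2 / (1 + t)) + ∫ t in (0 : ℝ)..T, ‖F2 t‖ ^ 2 / (1 + t)) := by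
        simp only [g]
        rw [intervalIntegral.integral_const_mul, intervalIntegral.integral_add]
        · refine ContinuousOn.intervalIntegrable ?_
          rw [uIcc_of_le hT0]
          exact ContinuousOn.div (hF1c.norm.pow 2).continuousOn (by fun_prop) fun t ht ↦ by have := ht.1; positivity
        · refine ContinuousOn.intervalIntegrable ?_
          rw [uIcc_of_le hT0]
          exact ContinuousOn.div (hF2c.norm.pow 2).continuousOn (by fun_prop) fun t ht ↦ by have := ht.1; positivity
    _ ≤ (L + 4) ^ m * AE ^ (k + 1) * (1 / 2) * (Q + Q) := by
        refine mul_le_mul_of_nonneg_left (add_le_add hJ1 hJ2) (by positivity)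
    _ = (L + 4) ^ m * AE ^ (k + 1) * Q := by ring

/-! ## Step 4: the main patterns (weighted mean value theorem) -/

/-- `g₀(a) = g₀(|a|)` (evenness) and as the real part. [folklore] -/
theorem g0_eq_ofReal_re_abs (a : ℝ) : g0 a = (((g0 |a|).re : ℝ) : ℂ) := by
  rcases le_or_gt 0 a with ha | ha
  · rw [abs_of_nonneg ha]; exact g0_eq_re a
  · rw [abs_of_neg ha, ← g0_neg a]; exact g0_eq_re (-a)

/-- `|ℓ(0)| ≤ 4`. [folklore] -/
theorem abs_ell_zero_le : |ell 0| ≤ 4 := by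
  have := abs_ell_le 0
  rw [abs_zero, zero_add] at this
  linarith [Real.log_two_lt_d9]

/-- **Main pattern** for the set `D` of density slots, `S = Dᶜ`, `m = |D|`:
`‖∫_0^T ℓ^m Π_{j∈S} (−𝒜_j) dt − (−1)^{|S|} I_m(T) 𝔖_S(ξ)‖ ≤ (2n+1)(log T+4)ⁿ · 1856 · 2 e^{n/4} T^{1−δ/2} SQ`.
[cite: RudnickSarnak1996, (3.45)–(3.47)] -/
theorem norm_integral_mainPattern_sub_le (hT : 2 ≤ T) (hbox : ∀ j, |ξ j| ≤ 2) (hsum : ∑ j, ξ j = 0)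
    {δ : ℝ} (hδ0 : 0 ≤ δ) (hδ : ∑ j, |ξ j| ≤ 2 - δ) (S : Finset (Fin (k + 1))) {m : ℕ} (hm : m ≤ k + 1) :
    ‖(∫ t in (0 : ℝ)..T, (ell t : ℂ) ^ m * ∏ j ∈ S, -primePoly (-(Real.log T * ξ j)) t) -
        (-1 : ℂ) ^ S.card * (ellInt m T : ℂ) * (diagSum T ξ S : ℂ)‖ ≤
      (2 * (k + 1) + 1) * (Real.log T + 4) ^ (k + 1) *
        (1856 * (2 * (Real.exp ((k + 1) / 4) * T ^ (1 - δ / 2)) * sqConst k T)) := by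
  classical
  have hT0 : (0 : ℝ) ≤ T := by linarith
  have hT1 : (1 : ℝ) ≤ T := by linarith
  have hL : 0 ≤ Real.log T := Real.log_nonneg hT1
  set L := Real.log T
  set Ns := lenBound k T
  set cp : ℕ → ℂ := fun n ↦ ((coefProd (posSide ξ S) (freq T ξ) n : ℝ) : ℂ)
  set cn : ℕ → ℂ := fun n ↦ ((coefProd (negSide ξ S) (freq T ξ) n : ℝ) : ℂ)
  set N1 := ∏ j ∈ posSide ξ S, suppBound (freq T ξ j)
  set N2 := ∏ j ∈ negSide ξ S, suppBound (freq T ξ j)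
  have hN1 : N1 ≤ Ns := prod_suppBound_le_lenBound hT1 hbox _
  have hN2 : N2 ≤ Ns := prod_suppBound_le_lenBound hT1 hbox _
  have hcp0 : ∀ n, N1 < n → cp n = 0 := fun n hn ↦ by
    simp only [cp]; rw [coefProd_eq_zero_of_lt _ _ hn]; simp
  have hcn0 : ∀ n, N2 < n → cn n = 0 := fun n hn ↦ by
    simp only [cn]; rw [coefProd_eq_zero_of_lt _ _ hn]; simp
  -- the product of the `−𝒜`'s as `(−1)^{|S|} F⁺ conj F⁻` with the common length
  have hprod : ∀ t, ∏ j ∈ S, -primePoly (-(L * ξ j)) t = (-1 : ℂ) ^ S.card * (dirPoly Ns cp t * conj (dirPoly Ns cn t)) := by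
    intro t
    rw [Finset.prod_neg, prod_primePoly_eq hT1, dirPoly_eq_of_le hN1 cp hcp0, dirPoly_eq_of_le hN2 cn hcn0]
  -- the weight
  set w : ℝ → ℂ := fun t ↦ (((ell t) ^ m : ℝ) : ℂ)
  set w' : ℝ → ℂ := fun t ↦ (((m : ℝ) * ell t ^ (m - 1) * ellDeriv t : ℝ) : ℂ)
  have hw : ∀ t ∈ Icc 0 T, HasDerivAt w (w' t) t := fun t _ ↦ ((hasDerivAt_ell t).pow m).ofReal_comp
  have hw'c : Continuous w' := Complex.continuous_ofReal.comp
    ((continuous_const.mul (continuous_ell.pow _)).mul continuous_ellDeriv)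
  have hmvt := norm_integral_weight_dirPoly_sub_le Ns cp cn hT0 hw hw'c.continuousOn
  -- identify the pieces
  have hwint : ∫ t in (0 : ℝ)..T, w t = (ellInt m T : ℂ) := by
    simp only [w, ellInt]; rw [intervalIntegral.integral_ofReal]
  have hdiag : ∑ n ∈ Finset.Icc 1 Ns, cp n * conj (cn n) = (diagSum T ξ S : ℂ) := by
    simp only [cp, cn, diagSum]
    push_cast
    refine Finset.sum_congr rfl fun n _ ↦ ?_
    rw [Complex.conj_ofReal]
  have hlhs : (∫ t in (0 : ℝ)..T, (ell t : ℂ) ^ m * ∏ j ∈ S, -primePoly (-(L * ξ j)) t) =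
      (-1 : ℂ) ^ S.card * ∫ t in (0 : ℝ)..T, w t * (dirPoly Ns cp t * conj (dirPoly Ns cn t)) := by
    rw [← intervalIntegral.integral_const_mul]
    refine intervalIntegral.integral_congr fun t _ ↦ ?_
    simp only [w]
    rw [hprod t]; push_cast; ring
  rw [hlhs, ← hwint, ← hdiag, mul_assoc, ← mul_sub, norm_mul, norm_pow, norm_neg, norm_one, one_pow, one_mul]
  refine hmvt.trans ?_
  -- bound the weight factor
  have hwT : ‖w T‖ ≤ (L + 4) ^ (k + 1) := by
    simp only [w]
    rw [Complex.norm_real, Real.norm_eq_abs, abs_pow]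
    refine (abs_ell_pow_le hT ⟨hT0, le_rfl⟩ m).trans ?_
    exact pow_le_pow_right₀ (by linarith) hm
  have hw'int : ∫ t in (0 : ℝ)..T, ‖w' t‖ ≤ 2 * (k + 1) * (L + 4) ^ (k + 1) := by
    have hpt : ∀ t ∈ Icc 0 T, ‖w' t‖ ≤ (m : ℝ) * (L + 4) ^ (m - 1) * ellDeriv t := by
      intro t ht
      simp only [w']
      rw [Complex.norm_real, Real.norm_eq_abs, abs_mul, abs_mul, abs_of_nonneg (ellDeriv_mem ht.1).1,
        Nat.abs_cast, abs_pow]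
      refine mul_le_mul_of_nonneg_right (mul_le_mul_of_nonneg_left (abs_ell_pow_le hT ht _) (Nat.cast_nonneg _))
        (ellDeriv_mem ht.1).1
    calc ∫ t in (0 : ℝ)..T, ‖w' t‖ ≤ ∫ t in (0 : ℝ)..T, (m : ℝ) * (L + 4) ^ (m - 1) * ellDeriv t :=
          intervalIntegral.integral_mono_on hT0 (hw'c.norm.intervalIntegrable _ _)
            ((continuous_const.mul continuous_ellDeriv).intervalIntegrable _ _) hpt
      _ = (m : ℝ) * (L + 4) ^ (m - 1) * (ell T - ell 0) := by
          rw [intervalIntegral.integral_const_mul, integral_ellDeriv]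
      _ ≤ (m : ℝ) * (L + 4) ^ (m - 1) * (2 * (L + 4)) := by
          refine mul_le_mul_of_nonneg_left ?_ (by positivity)
          have h1 := abs_ell_le_of_mem (T := T) (t := T) ⟨hT0, le_rfl⟩
          have h2 := log_add_two_le hT (t := T) ⟨hT0, le_rfl⟩
          have h3 := abs_ell_zero_le
          linarith [le_abs_self (ell T), neg_abs_le (ell 0)]
      _ ≤ (k + 1 : ℝ) * (L + 4) ^ k * (2 * (L + 4)) := by
          have hm' : (m : ℝ) ≤ k + 1 := by exact_mod_cast hm
          have hp : (L + 4) ^ (m - 1) ≤ (L + 4) ^ k := pow_le_pow_right₀ (by linarith) (by omega)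
          have : (m : ℝ) * (L + 4) ^ (m - 1) ≤ (k + 1) * (L + 4) ^ k :=
            mul_le_mul hm' hp (by positivity) (by positivity)
          exact mul_le_mul_of_nonneg_right this (by positivity)
      _ = 2 * (k + 1) * (L + 4) ^ (k + 1) := by ring
  -- bound the coefficient factor
  obtain ⟨hpos, hneg⟩ := sum_freq_side_le hT1 hsum hδ S
  have hposL : ∑ j ∈ posSide ξ S, freq T ξ j ≤ L := hpos.trans (by nlinarith)
  have hnegL : ∑ j ∈ negSide ξ S, freq T ξ j ≤ L := hneg.trans (by nlinarith)
  obtain ⟨-, hB1⟩ := sum_sq_side_le (ξ := ξ) hT1 (posSide ξ S) hposL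
  obtain ⟨-, hB2⟩ := sum_sq_side_le (ξ := ξ) hT1 (negSide ξ S) hnegL
  obtain ⟨hN1r, hN2r⟩ := prod_suppBound_side_le hT1 hsum hδ S
  have hSQ := one_le_sqConst k T
  have hcoef : ∑ n ∈ Finset.Icc 1 Ns, (n : ℝ) * (‖cp n‖ ^ 2 + ‖cn n‖ ^ 2) ≤
      2 * (Real.exp ((k + 1) / 4) * T ^ (1 - δ / 2)) * sqConst k T := by
    have e1 : ∑ n ∈ Finset.Icc 1 Ns, (n : ℝ) * ‖cp n‖ ^ 2 = ∑ n ∈ Finset.Icc 1 N1, (n : ℝ) * coefProd (posSide ξ S) (freq T ξ) n ^ 2 := by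
      have h : ∑ n ∈ Finset.Icc 1 N1, (n : ℝ) * ‖cp n‖ ^ 2 = ∑ n ∈ Finset.Icc 1 Ns, (n : ℝ) * ‖cp n‖ ^ 2 :=
        Finset.sum_subset (Finset.Icc_subset_Icc_right hN1) fun n hn hn' ↦ by
          rw [Finset.mem_Icc] at hn hn'
          rw [hcp0 n (by omega)]; simp
      rw [← h]
      exact Finset.sum_congr rfl fun n _ ↦ by simp only [cp]; rw [Complex.norm_real, Real.norm_eq_abs, sq_abs]
    have e2 : ∑ n ∈ Finset.Icc 1 Ns, (n : ℝ) * ‖cn n‖ ^ 2 = ∑ n ∈ Finset.Icc 1 N2, (n : ℝ) * coefProd (negSide ξ S) (freq T ξ) n ^ 2 := by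
      have h : ∑ n ∈ Finset.Icc 1 N2, (n : ℝ) * ‖cn n‖ ^ 2 = ∑ n ∈ Finset.Icc 1 Ns, (n : ℝ) * ‖cn n‖ ^ 2 :=
        Finset.sum_subset (Finset.Icc_subset_Icc_right hN2) fun n hn hn' ↦ by
          rw [Finset.mem_Icc] at hn hn'
          rw [hcn0 n (by omega)]; simp
      rw [← h]
      exact Finset.sum_congr rfl fun n _ ↦ by simp only [cn]; rw [Complex.norm_real, Real.norm_eq_abs, sq_abs]
    have hsplit : ∑ n ∈ Finset.Icc 1 Ns, (n : ℝ) * (‖cp n‖ ^ 2 + ‖cn n‖ ^ 2) =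
        (∑ n ∈ Finset.Icc 1 Ns, (n : ℝ) * ‖cp n‖ ^ 2) + ∑ n ∈ Finset.Icc 1 Ns, (n : ℝ) * ‖cn n‖ ^ 2 := by
      rw [← Finset.sum_add_distrib]; exact Finset.sum_congr rfl fun n _ ↦ by ring
    rw [hsplit, e1, e2]
    have hS0 : 0 ≤ sqConst k T := by linarith
    calc _ ≤ (N1 : ℝ) * sqConst k T + (N2 : ℝ) * sqConst k T := add_le_add hB1 hB2
      _ ≤ (Real.exp ((k + 1) / 4) * T ^ (1 - δ / 2)) * sqConst k T + (Real.exp ((k + 1) / 4) * T ^ (1 - δ / 2)) * sqConst k T :=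
          add_le_add (mul_le_mul_of_nonneg_right hN1r hS0) (mul_le_mul_of_nonneg_right hN2r hS0)
      _ = _ := by ring
  have hfac : ‖w T‖ + ∫ t in (0 : ℝ)..T, ‖w' t‖ ≤ (2 * (k + 1) + 1) * (L + 4) ^ (k + 1) := by linarith
  have hfac0 : 0 ≤ ‖w T‖ + ∫ t in (0 : ℝ)..T, ‖w' t‖ :=
    add_nonneg (norm_nonneg _) (intervalIntegral.integral_nonneg hT0 fun t _ ↦ norm_nonneg _)
  calc (‖w T‖ + ∫ t in (0 : ℝ)..T, ‖w' t‖) * (1856 * ∑ n ∈ Finset.Icc 1 Ns, (n : ℝ) * (‖cp n‖ ^ 2 + ‖cn n‖ ^ 2))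
      ≤ ((2 * (k + 1) + 1) * (L + 4) ^ (k + 1)) * (1856 * (2 * (Real.exp ((k + 1) / 4) * T ^ (1 - δ / 2)) * sqConst k T)) :=
        mul_le_mul hfac (mul_le_mul_of_nonneg_left hcoef (by norm_num)) (by positivity) (by positivity)
    _ = _ := by ring

/-! ## Step 5: assembly -/

/-- `SQ ≤ M₂ⁿ (log T + k + 5)ⁿ` with `M₂ = max 1 C₂`. [folklore] -/
theorem sqConst_le (hT : 1 ≤ T) (k : ℕ) :
    sqConst k T ≤ (max 1 (bumpMass * coefL1Const * Real.exp (1 / 8))) ^ (k + 1) * (Real.log T + k + 5) ^ (k + 1) := by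
  have hL : 0 ≤ Real.log T := Real.log_nonneg hT
  unfold sqConst
  rw [← mul_pow]
  refine pow_le_pow_left₀ (zero_le_one.trans (le_max_left _ _)) (max_le ?_ ?_) _
  · have h1 : (1 : ℝ) ≤ max 1 (bumpMass * coefL1Const * Real.exp (1 / 8)) := le_max_left _ _
    have h2 : (1 : ℝ) ≤ Real.log T + k + 5 := by have hk0 : (0 : ℝ) ≤ k := Nat.cast_nonneg k; linarith
    nlinarith
  · have h1 : bumpMass * coefL1Const * Real.exp (1 / 8) ≤ max 1 (bumpMass * coefL1Const * Real.exp (1 / 8)) := le_max_right _ _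
    have h0 : 0 ≤ bumpMass * coefL1Const * Real.exp (1 / 8) := by
      have := bumpMass_pos; have := coefL1Const_pos; positivity
    have h2 : Real.log T + (k + 1) ≤ Real.log T + k + 5 := by linarith
    exact mul_le_mul h1 h2 (by positivity) (zero_le_one.trans (le_max_left _ _))

/-- **The `t`-integral of the slot product is the pattern sum up to `O(L^c T^{1−δ/2})`**
(Rudnick–Sarnak 1996, (3.19)–(3.20) and (3.45)–(3.47), in the `t`-windowed form; RH): there is
`C = C(n)` with, for all `T ≥ 2` and all slice points `ξ` (`|ξ_j| ≤ 2`, `Σ ξ_j = 0`, `Σ|ξ_j| ≤ 2−δ`),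
`‖V_T(ξ) − Σ_D (−1)^{n−|D|} Π_{j∈D} g₀(b_j) I_{|D|}(T) 𝔖_{Dᶜ}(ξ)‖ ≤ C (log T + n + 4)^{3n+1} T^{1−δ/2}`.
[cite: RudnickSarnak1996, (3.45)–(3.47)] -/
theorem norm_slotIntegral_sub_patternSum_le (hRH : RiemannHypothesis) (k : ℕ) {δ : ℝ} (hδ0 : 0 < δ) :
    ∃ C : ℝ, 0 ≤ C ∧ ∀ T : ℝ, 2 ≤ T → ∀ ξ : Fin (k + 1) → ℝ, (∀ j, |ξ j| ≤ 2) → ∑ j, ξ j = 0 →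
      ∑ j, |ξ j| ≤ 2 - δ →
        ‖slotIntegral T ξ - patternSum T ξ‖ ≤ C * (Real.log T + k + 5) ^ (3 * (k + 1) + 1) * T ^ (1 - δ / 2) := by
  classical
  -- the constants
  set Kc : ℝ := max (max slotBConst remConst) 1
  set AE : ℝ := max archErrConst 1
  set M₂ : ℝ := max 1 (bumpMass * coefL1Const * Real.exp (1 / 8))
  set Bg : ℝ := max bumpMass 1
  set en : ℝ := Real.exp ((k + 1) / 4)
  set c₁ : ℝ := 2 ^ (k + 1) * Kc ^ (k + 1) * 2
  set c₂ : ℝ := AE ^ (k + 1) * (36 * en + 10) * M₂ ^ (k + 1)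
  set c₃ : ℝ := (2 * (k + 1) + 1) * (1856 * (2 * en)) * M₂ ^ (k + 1)
  have hKc : 1 ≤ Kc := le_max_right _ _
  have hAE : 1 ≤ AE := le_max_right _ _
  have hM₂ : 1 ≤ M₂ := le_max_left _ _
  have hBg : 1 ≤ Bg := le_max_right _ _
  have hen : 0 < en := Real.exp_pos _
  have hc₁ : 0 ≤ c₁ := by positivity
  have hc₂ : 0 ≤ c₂ := by positivity
  have hc₃ : 0 ≤ c₃ := by positivity
  refine ⟨c₁ + 2 ^ (k + 1) * Bg ^ (k + 1) * (2 ^ (k + 1) * c₂ + c₃), by positivity, ?_⟩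
  intro T hT ξ hbox hsum hδ
  have hT0 : (0 : ℝ) ≤ T := by linarith
  have hT1 : (1 : ℝ) ≤ T := by linarith
  set L := Real.log T
  have hL : 0 ≤ L := Real.log_nonneg hT1
  have hδ2 : δ ≤ 2 := by linarith [Finset.sum_nonneg fun j (_ : j ∈ Finset.univ) ↦ abs_nonneg (ξ j)]
  have hk0 : (0 : ℝ) ≤ k := Nat.cast_nonneg k
  set X : ℝ := L + k + 5
  have hX1 : 1 ≤ X := by simp only [X]; linarith
  have hX0 : 0 ≤ X := zero_le_one.trans hX1
  have hL2X : L + 2 ≤ X := by simp only [X]; linarith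
  have hL4X : L + 4 ≤ X := by simp only [X]; linarith
  have h10X : 5 + 5 * (L + 1) ≤ 10 * X := by simp only [X]; linarith
  set Tc : ℝ := T ^ (1 - δ / 2)
  have hTc1 : 1 ≤ Tc := Real.one_le_rpow hT1 (by linarith)
  have hTc0 : 0 ≤ Tc := zero_le_one.trans hTc1
  set p := 3 * (k + 1) + 1
  have hXpow : ∀ q, q ≤ p → X ^ q ≤ X ^ p := fun q hq ↦ pow_le_pow_right₀ hX1 hq
  have hSQ : sqConst k T ≤ M₂ ^ (k + 1) * X ^ (k + 1) := sqConst_le hT1 k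
  have hSQ0 : 0 ≤ sqConst k T := zero_le_one.trans (one_le_sqConst k T)
  -- (1) `E₁`
  have hE1 : ‖slotIntegral T ξ - ∫ t in (0 : ℝ)..T, ∏ j, slotB (-(L * ξ j)) t‖ ≤ c₁ * X ^ p * Tc := by
    refine (norm_slotIntegral_sub_integral_prod_slotB_le hRH hT hsum).trans ?_
    have hexp : Real.exp ((∑ j, freq T ξ j) / 2) ≤ Tc := by
      have : (∑ j, freq T ξ j) / 2 ≤ L * (1 - δ / 2) := by
        unfold freq; rw [← Finset.mul_sum]; nlinarith
      calc Real.exp ((∑ j, freq T ξ j) / 2) ≤ Real.exp (L * (1 - δ / 2)) := Real.exp_le_exp.2 this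
        _ = Tc := exp_log_mul_eq_rpow hT1 _
    have h2 : (Kc * (L + 2)) ^ (k + 1) ≤ Kc ^ (k + 1) * X ^ p := by
      rw [mul_pow]
      refine mul_le_mul_of_nonneg_left ((pow_le_pow_left₀ (by linarith) hL2X _).trans (hXpow _ (by omega))) (by positivity)
    calc 2 ^ (k + 1) * (Kc * (L + 2)) ^ (k + 1) * Real.exp ((∑ j, freq T ξ j) / 2) * 2
        ≤ 2 ^ (k + 1) * (Kc ^ (k + 1) * X ^ p) * Tc * 2 := by
          refine mul_le_mul_of_nonneg_right (mul_le_mul (mul_le_mul_of_nonneg_left h2 (by positivity)) hexp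
            (Real.exp_pos _).le (by positivity)) (by norm_num)
      _ = c₁ * X ^ p * Tc := by simp only [c₁]; ring
  -- (2) `E₂` per pattern
  have hE2 : ∀ (A' E : Finset (Fin (k + 1))), E.Nonempty → ∀ m, m ≤ k + 1 →
      ‖∫ t in (0 : ℝ)..T, (ell t : ℂ) ^ m *
          ((∏ j ∈ A', -primePoly (-(L * ξ j)) t) * ∏ j ∈ E, archErr (-(L * ξ j)) t)‖ ≤ c₂ * X ^ p * Tc := by
    intro A' E hE m hm
    refine (norm_integral_errPattern_le hT hsum hδ0.le hδ A' E hE m).trans ?_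
    have h1 : (L + 4) ^ m ≤ X ^ (k + 1) :=
      (pow_le_pow_left₀ (by linarith) hL4X m).trans (pow_le_pow_right₀ hX1 hm)
    have h2 : 36 * (en * Tc) + 5 + 5 * (L + 1) ≤ (36 * en + 10) * X * Tc := by
      have : 5 + 5 * (L + 1) ≤ 10 * X * Tc := by nlinarith
      nlinarith [mul_nonneg (mul_nonneg (by norm_num : (0:ℝ) ≤ 36) hen.le) (mul_nonneg (by linarith : (0:ℝ) ≤ X - 1) hTc0)]
    have h20 : 0 ≤ 36 * (en * Tc) + 5 + 5 * (L + 1) := by positivity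
    calc (L + 4) ^ m * AE ^ (k + 1) * ((36 * (en * Tc) + 5 + 5 * (L + 1)) * sqConst k T)
        ≤ X ^ (k + 1) * AE ^ (k + 1) * (((36 * en + 10) * X * Tc) * (M₂ ^ (k + 1) * X ^ (k + 1))) :=
          mul_le_mul (mul_le_mul_of_nonneg_right h1 (by positivity)) (mul_le_mul h2 hSQ hSQ0 (by positivity))
            (by positivity) (by positivity)
      _ = c₂ * X ^ (2 * (k + 1) + 1) * Tc := by simp only [c₂]; ring
      _ ≤ c₂ * X ^ p * Tc := by
          refine mul_le_mul_of_nonneg_right (mul_le_mul_of_nonneg_left (hXpow _ (by omega)) hc₂) hTc0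
  -- (3) main patterns
  have hE3 : ∀ D : Finset (Fin (k + 1)),
      ‖(∫ t in (0 : ℝ)..T, (ell t : ℂ) ^ D.card * ∏ j ∈ Finset.univ \ D, -primePoly (-(L * ξ j)) t) -
          (-1 : ℂ) ^ (Finset.univ \ D).card * (ellInt D.card T : ℂ) * (diagSum T ξ (Finset.univ \ D) : ℂ)‖ ≤
        c₃ * X ^ p * Tc := by
    intro D
    have hm : D.card ≤ k + 1 := by have := D.card_le_univ; rwa [Fintype.card_fin] at this
    refine (norm_integral_mainPattern_sub_le hT hbox hsum hδ0.le hδ _ hm).trans ?_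
    have h1 : (L + 4) ^ (k + 1) ≤ X ^ (k + 1) := pow_le_pow_left₀ (by linarith) hL4X _
    calc (2 * (k + 1) + 1) * (L + 4) ^ (k + 1) * (1856 * (2 * (en * Tc) * sqConst k T))
        ≤ (2 * (k + 1) + 1) * X ^ (k + 1) * (1856 * (2 * (en * Tc) * (M₂ ^ (k + 1) * X ^ (k + 1)))) :=
          mul_le_mul (mul_le_mul_of_nonneg_left h1 (by positivity))
            (mul_le_mul_of_nonneg_left (mul_le_mul_of_nonneg_left hSQ (by positivity)) (by norm_num))
            (by positivity) (by positivity)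
      _ = c₃ * X ^ (2 * (k + 1)) * Tc := by simp only [c₃]; ring
      _ ≤ c₃ * X ^ p * Tc := mul_le_mul_of_nonneg_right (mul_le_mul_of_nonneg_left (hXpow _ (by omega)) hc₃) hTc0
  -- (4) the expansion of `∫ Π B`
  set I : Finset (Fin (k + 1)) → Finset (Fin (k + 1)) → ℂ := fun D A' ↦
    ∫ t in (0 : ℝ)..T, (ell t : ℂ) ^ D.card *
      ((∏ j ∈ A', -primePoly (-(L * ξ j)) t) * ∏ j ∈ (Finset.univ \ D) \ A', archErr (-(L * ξ j)) t)
  have hcontH : ∀ D A' : Finset (Fin (k + 1)), Continuous fun t ↦ (ell t : ℂ) ^ D.card *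
      ((∏ j ∈ A', -primePoly (-(L * ξ j)) t) * ∏ j ∈ (Finset.univ \ D) \ A', archErr (-(L * ξ j)) t) := by
    intro D A'
    refine ((Complex.continuous_ofReal.comp continuous_ell).pow _).mul (Continuous.mul ?_ ?_)
    · exact continuous_finsetProd _ fun j _ ↦ (continuous_primePoly _).neg
    · exact continuous_finsetProd _ fun j _ ↦ continuous_archErr _
  have hexp : ∫ t in (0 : ℝ)..T, ∏ j, slotB (-(L * ξ j)) t =
      ∑ D ∈ (Finset.univ : Finset (Fin (k + 1))).powerset, (∏ j ∈ D, g0 (-(L * ξ j))) *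
        ∑ A' ∈ (Finset.univ \ D).powerset, I D A' := by
    rw [intervalIntegral.integral_congr fun t _ ↦ prod_slotB_eq (fun j ↦ -(L * ξ j)) t]
    have hterm : ∀ D : Finset (Fin (k + 1)), (fun t : ℝ ↦ (∏ j ∈ D, g0 (-(L * ξ j))) * (ell t : ℂ) ^ D.card *
        ∑ A' ∈ (Finset.univ \ D).powerset,
          (∏ j ∈ A', -primePoly (-(L * ξ j)) t) * ∏ j ∈ (Finset.univ \ D) \ A', archErr (-(L * ξ j)) t) =
        fun t ↦ (∏ j ∈ D, g0 (-(L * ξ j))) * ∑ A' ∈ (Finset.univ \ D).powerset, ((ell t : ℂ) ^ D.card *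
          ((∏ j ∈ A', -primePoly (-(L * ξ j)) t) * ∏ j ∈ (Finset.univ \ D) \ A', archErr (-(L * ξ j)) t)) := by
      intro D; funext t; rw [mul_assoc, Finset.mul_sum]
    have hint : ∀ D ∈ (Finset.univ : Finset (Fin (k + 1))).powerset, IntervalIntegrable (fun t : ℝ ↦
        (∏ j ∈ D, g0 (-(L * ξ j))) * (ell t : ℂ) ^ D.card * ∑ A' ∈ (Finset.univ \ D).powerset,
          (∏ j ∈ A', -primePoly (-(L * ξ j)) t) * ∏ j ∈ (Finset.univ \ D) \ A', archErr (-(L * ξ j)) t) volume 0 T := by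
      intro D _
      rw [hterm D]
      exact (continuous_const.mul (continuous_finsetSum _ fun A' _ ↦ hcontH D A')).intervalIntegrable _ _
    rw [intervalIntegral.integral_finsetSum hint]
    refine Finset.sum_congr rfl fun D _ ↦ ?_
    rw [hterm D, intervalIntegral.integral_const_mul,
      intervalIntegral.integral_finsetSum fun A' _ ↦ (hcontH D A').intervalIntegrable _ _]
  -- (5) the `g₀` factors
  have hg : ∀ D : Finset (Fin (k + 1)), ∏ j ∈ D, g0 (-(L * ξ j)) = ((∏ j ∈ D, (g0 (freq T ξ j)).re : ℝ) : ℂ) := by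
    intro D
    push_cast
    refine Finset.prod_congr rfl fun j _ ↦ ?_
    rw [g0_eq_ofReal_re_abs, abs_neg_log_mul hT1]
  have hgn : ∀ D : Finset (Fin (k + 1)), ‖∏ j ∈ D, g0 (-(L * ξ j))‖ ≤ Bg ^ (k + 1) := by
    intro D
    rw [norm_prod]
    have hm : D.card ≤ k + 1 := by have := D.card_le_univ; rwa [Fintype.card_fin] at this
    calc ∏ j ∈ D, ‖g0 (-(L * ξ j))‖ ≤ ∏ _j ∈ D, Bg :=
          Finset.prod_le_prod (fun j _ ↦ norm_nonneg _) fun j _ ↦ (norm_g0_le _).trans (le_max_left _ _)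
      _ = Bg ^ D.card := Finset.prod_const _
      _ ≤ Bg ^ (k + 1) := pow_le_pow_right₀ hBg hm
  -- (6) the algebraic decomposition
  have hmainA : ∀ D : Finset (Fin (k + 1)), I D (Finset.univ \ D) =
      ∫ t in (0 : ℝ)..T, (ell t : ℂ) ^ D.card * ∏ j ∈ Finset.univ \ D, -primePoly (-(L * ξ j)) t := by
    intro D
    simp only [I]
    refine intervalIntegral.integral_congr fun t _ ↦ ?_
    simp only [Finset.sdiff_self, Finset.prod_empty, mul_one]
  have hdecomp : slotIntegral T ξ - patternSum T ξ =
      (slotIntegral T ξ - ∫ t in (0 : ℝ)..T, ∏ j, slotB (-(L * ξ j)) t) +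
        ∑ D ∈ (Finset.univ : Finset (Fin (k + 1))).powerset, (∏ j ∈ D, g0 (-(L * ξ j))) *
          ((∑ A' ∈ ((Finset.univ \ D).powerset).erase (Finset.univ \ D), I D A') +
            (I D (Finset.univ \ D) - (-1 : ℂ) ^ (Finset.univ \ D).card * (ellInt D.card T : ℂ) *
              (diagSum T ξ (Finset.univ \ D) : ℂ))) := by
    have hP : patternSum T ξ = ∑ D ∈ (Finset.univ : Finset (Fin (k + 1))).powerset, (∏ j ∈ D, g0 (-(L * ξ j))) *
        ((-1 : ℂ) ^ (Finset.univ \ D).card * (ellInt D.card T : ℂ) * (diagSum T ξ (Finset.univ \ D) : ℂ)) := by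
      unfold patternSum
      refine Finset.sum_congr rfl fun D _ ↦ ?_
      rw [hg D]; ring
    have hS : ∀ D : Finset (Fin (k + 1)), ∑ A' ∈ (Finset.univ \ D).powerset, I D A' =
        (∑ A' ∈ ((Finset.univ \ D).powerset).erase (Finset.univ \ D), I D A') + I D (Finset.univ \ D) := by
      intro D
      rw [← Finset.add_sum_erase _ _ (Finset.mem_powerset_self _), add_comm]
    rw [hP, hexp]
    simp_rw [hS]
    have e : ∑ D ∈ (Finset.univ : Finset (Fin (k + 1))).powerset, (∏ j ∈ D, g0 (-(L * ξ j))) *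
        ((∑ A' ∈ ((Finset.univ \ D).powerset).erase (Finset.univ \ D), I D A') +
          (I D (Finset.univ \ D) - (-1 : ℂ) ^ (Finset.univ \ D).card * (ellInt D.card T : ℂ) *
            (diagSum T ξ (Finset.univ \ D) : ℂ))) =
        (∑ D ∈ (Finset.univ : Finset (Fin (k + 1))).powerset, (∏ j ∈ D, g0 (-(L * ξ j))) *
          ((∑ A' ∈ ((Finset.univ \ D).powerset).erase (Finset.univ \ D), I D A') + I D (Finset.univ \ D))) -
        ∑ D ∈ (Finset.univ : Finset (Fin (k + 1))).powerset, (∏ j ∈ D, g0 (-(L * ξ j))) *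
          ((-1 : ℂ) ^ (Finset.univ \ D).card * (ellInt D.card T : ℂ) * (diagSum T ξ (Finset.univ \ D) : ℂ)) := by
      rw [← Finset.sum_sub_distrib]
      exact Finset.sum_congr rfl fun D _ ↦ by ring
    rw [e]; ring
  -- (7) the estimate
  rw [hdecomp]
  refine (norm_add_le _ _).trans ?_
  have hsumD : ‖∑ D ∈ (Finset.univ : Finset (Fin (k + 1))).powerset, (∏ j ∈ D, g0 (-(L * ξ j))) *
      ((∑ A' ∈ ((Finset.univ \ D).powerset).erase (Finset.univ \ D), I D A') +
        (I D (Finset.univ \ D) - (-1 : ℂ) ^ (Finset.univ \ D).card * (ellInt D.card T : ℂ) *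
          (diagSum T ξ (Finset.univ \ D) : ℂ)))‖ ≤
      2 ^ (k + 1) * Bg ^ (k + 1) * (2 ^ (k + 1) * c₂ + c₃) * X ^ p * Tc := by
    refine (norm_sum_le _ _).trans ?_
    have hD : ∀ D ∈ (Finset.univ : Finset (Fin (k + 1))).powerset, ‖(∏ j ∈ D, g0 (-(L * ξ j))) *
        ((∑ A' ∈ ((Finset.univ \ D).powerset).erase (Finset.univ \ D), I D A') +
          (I D (Finset.univ \ D) - (-1 : ℂ) ^ (Finset.univ \ D).card * (ellInt D.card T : ℂ) *
            (diagSum T ξ (Finset.univ \ D) : ℂ)))‖ ≤ Bg ^ (k + 1) * ((2 ^ (k + 1) * c₂ + c₃) * X ^ p * Tc) := by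
      intro D _
      rw [norm_mul]
      refine mul_le_mul (hgn D) ?_ (norm_nonneg _) (by positivity)
      refine (norm_add_le _ _).trans ?_
      have hm : D.card ≤ k + 1 := by have := D.card_le_univ; rwa [Fintype.card_fin] at this
      have h1 : ‖∑ A' ∈ ((Finset.univ \ D).powerset).erase (Finset.univ \ D), I D A'‖ ≤ 2 ^ (k + 1) * (c₂ * X ^ p * Tc) := by
        refine (norm_sum_le _ _).trans ?_
        have hA : ∀ A' ∈ ((Finset.univ \ D).powerset).erase (Finset.univ \ D), ‖I D A'‖ ≤ c₂ * X ^ p * Tc := by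
          intro A' hA'
          obtain ⟨hne, hsub⟩ := Finset.mem_erase.1 hA'
          rw [Finset.mem_powerset] at hsub
          have hE : ((Finset.univ \ D) \ A').Nonempty := by
            rw [Finset.sdiff_nonempty]; intro h; exact hne (Finset.Subset.antisymm hsub h)
          exact hE2 A' _ hE _ hm
        refine (Finset.sum_le_sum hA).trans ?_
        rw [Finset.sum_const, nsmul_eq_mul]
        refine mul_le_mul_of_nonneg_right ?_ (by positivity)
        have hc : (((Finset.univ \ D).powerset).erase (Finset.univ \ D)).card ≤ 2 ^ (k + 1) := by
          refine (Finset.card_erase_le).trans ?_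
          rw [Finset.card_powerset]
          refine Nat.pow_le_pow_right (by norm_num) ?_
          have := (Finset.univ \ D).card_le_univ; rwa [Fintype.card_fin] at this
        exact_mod_cast hc
      have h2 := hE3 D
      rw [hmainA D] 
      calc ‖∑ A' ∈ ((Finset.univ \ D).powerset).erase (Finset.univ \ D), I D A'‖ +
            ‖(∫ t in (0 : ℝ)..T, (ell t : ℂ) ^ D.card * ∏ j ∈ Finset.univ \ D, -primePoly (-(L * ξ j)) t) -
              (-1 : ℂ) ^ (Finset.univ \ D).card * (ellInt D.card T : ℂ) * (diagSum T ξ (Finset.univ \ D) : ℂ)‖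
          ≤ 2 ^ (k + 1) * (c₂ * X ^ p * Tc) + c₃ * X ^ p * Tc := add_le_add h1 h2
        _ = (2 ^ (k + 1) * c₂ + c₃) * X ^ p * Tc := by ring
    refine (Finset.sum_le_sum hD).trans ?_
    rw [Finset.sum_const, Finset.card_powerset, Finset.card_univ, Fintype.card_fin, nsmul_eq_mul]
    push_cast
    exact le_of_eq (by ring)
  calc ‖slotIntegral T ξ - ∫ t in (0 : ℝ)..T, ∏ j, slotB (-(L * ξ j)) t‖ + _
      ≤ c₁ * X ^ p * Tc + 2 ^ (k + 1) * Bg ^ (k + 1) * (2 ^ (k + 1) * c₂ + c₃) * X ^ p * Tc := add_le_add hE1 hsumD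
    _ = (c₁ + 2 ^ (k + 1) * Bg ^ (k + 1) * (2 ^ (k + 1) * c₂ + c₃)) * X ^ p * Tc := by ring

end RudnickSarnakN

end Literature.NumberTheory.LFunctions

end
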